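import Literature.AlgebraicGeometry.ShimuraVarieties.HeckeCorrespondenceAction
import Mathlib.Topology.Algebra.ConstMulAction
import Mathlib.Topology.Compactness.LocallyCompact
import Mathlib.Topology.Separation.Hausdorff

/-!
# The ball of negative lines is locally compact Hausdorff (crux `EndoscopicMiddleDegree.OrthogonalEnveloped`,
# stmt-HodgeConjecture-14300; `--supports`; line `purity-sorted-hecke-envelope` / `HeckeGraphChow`, seat c2)

The point-set half of the prerequisite (G1) of the residual construction stub `stub_heckeGraphAnalytic`
("`Γ` acts freely and properly discontinuously on the ball `𝔹`, and `𝔹` is locally compact Hausdorff";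
cf. `stub_levelCoveringOfProperlyDiscontinuous`, `Theorems/…LevelCovering`, which takes
`[LocallyCompactSpace D.ball] [T2Space D.ball]` as hypotheses).

For a ball-quotient datum `D` the ball is `D.ball = D.cone / ℂˣ`, the open negative cone
`D.cone = {v ∈ ℂ^{p+1} | ⟪v, v⟫ < 0}` of `V_{τ₁}` modulo non-zero scalars, with the QUOTIENT topology
(BMM Part 2 §1.3: the symmetric space of `U(p, 1)` is the space of negative lines). We prove:

* `ℂˣ` acts on the cone by homeomorphisms, so `toBall : D.cone → D.ball` is an OPEN quotient map
  (`isOpenQuotientMap_toBall`, Mathlib `MulAction.isOpenQuotientMap_quotientMk`);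
* two cone vectors span the same line iff all their `2 × 2` minors vanish (`toBall_eq_toBall_iff_minors`;
  cone vectors are non-zero), a CLOSED condition, so the ball is Hausdorff
  (`t2Space_iff_of_isOpenQuotientMap`);
* the cone is open in the locally compact `ℂ^{p+1}`, hence locally compact, and so is its open quotient
  (`IsOpenQuotientMap.locallyCompactSpace`);
* `stub_ballLocallyCompactT2` (REGISTERED stub of the crux): `LocallyCompactSpace D.ball ∧ T2Space D.ball`.

References: BMM arXiv:1306.1515 = Acta Math. 216 (2016), Part 2 §1.3; N. Bourbaki, *Topologie générale*,
Ch. I §8.3 Prop. 8 (Hausdorff quotients by open equivalence relations) and §9.7 Prop. 12–13.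
-/

noncomputable section

-- The crux-workfile namespace `Summit.<P>.<Sub>.Cruxes.…` repeats `HodgeConjecture` (single-conjunct summit).
set_option linter.dupNamespace false

namespace Summit.HodgeConjecture.HodgeConjecture.Cruxes.OrthogonalEnveloped.HeckeGraphChow

open Matrix
open Literature.AlgebraicGeometry.Motives (SchemeOver)
open Literature.AlgebraicGeometry.ShimuraVarieties

namespace BallTopology

variable {p : ℕ} {X : SchemeOver ℂ} (D : UnitaryBallQuotientDatum p X)

/-- Non-zero scalars act on the negative cone by homeomorphisms (a `Prop`-valued class, recorded as a
theorem and used locally through `haveI`). [folklore] -/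
theorem continuousConstSMul_unitsCone : ContinuousConstSMul ℂˣ D.cone where
  continuous_const_smul c :=
    ((continuous_const_smul (c : ℂ)).comp continuous_subtype_val).subtype_mk _

/-- The projection `cone → ball = cone / ℂˣ` is an open quotient map.
[cite: BergeronMillsonMoeglin2016Balls, Part 2 §1.3] -/
theorem isOpenQuotientMap_toBall : IsOpenQuotientMap D.toBall :=
  haveI := continuousConstSMul_unitsCone D
  MulAction.isOpenQuotientMap_quotientMk

/-- Vectors of the negative cone are non-zero (`⟪0, 0⟫ = 0`). [folklore] -/
theorem coe_ne_zero (v : D.cone) : (v : Fin (p + 1) → ℂ) ≠ 0 := by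
  intro h
  have hv : (star (v : Fin (p + 1) → ℂ) ⬝ᵥ (D.Hℂ *ᵥ (v : Fin (p + 1) → ℂ))).re < 0 :=
    mem_negCone_iff.1 v.2
  rw [h, Matrix.mulVec_zero, dotProduct_zero, Complex.zero_re] at hv
  exact lt_irrefl 0 hv

/-- Two cone vectors span the same negative line iff all their `2 × 2` minors vanish (they are
non-zero). [folklore] -/
theorem toBall_eq_toBall_iff_minors (v w : D.cone) :
    D.toBall v = D.toBall w ↔
      ∀ i j, (v : Fin (p + 1) → ℂ) i * (w : Fin (p + 1) → ℂ) j =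
        (v : Fin (p + 1) → ℂ) j * (w : Fin (p + 1) → ℂ) i := by
  rw [D.toBall_eq_toBall_iff]
  constructor
  · rintro ⟨c, rfl⟩ i j
    simp only [UnitaryBallQuotientDatum.coe_units_smul, Pi.smul_apply, smul_eq_mul]
    ring
  · intro h
    obtain ⟨j, hj⟩ : ∃ j, (w : Fin (p + 1) → ℂ) j ≠ 0 := by
      by_contra hall
      push Not at hall
      exact coe_ne_zero D w (funext hall)
    set c : ℂ := (v : Fin (p + 1) → ℂ) j / (w : Fin (p + 1) → ℂ) j with hc_def
    have hv : (v : Fin (p + 1) → ℂ) = c • (w : Fin (p + 1) → ℂ) := by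
      funext i
      rw [Pi.smul_apply, smul_eq_mul, hc_def, div_mul_eq_mul_div, ← h i j, mul_div_assoc,
        div_self hj, mul_one]
    have hc : c ≠ 0 := by
      intro hc
      apply coe_ne_zero D v
      rw [hv, hc, zero_smul]
    exact ⟨Units.mk0 c hc, Subtype.ext (by rw [UnitaryBallQuotientDatum.coe_units_smul, hv]; rfl)⟩

/-- **The ball is Hausdorff**: `toBall` is an open quotient map and "`v`, `w` are proportional" is a
closed condition on `cone × cone` (vanishing of the `2 × 2` minors).
[cite: BergeronMillsonMoeglin2016Balls, Part 2 §1.3] -/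
theorem t2Space_ball : T2Space D.ball := by
  rw [t2Space_iff_of_isOpenQuotientMap (isOpenQuotientMap_toBall D)]
  have hset : {q : D.cone × D.cone | D.toBall q.1 = D.toBall q.2} =
      ⋂ i : Fin (p + 1), ⋂ j : Fin (p + 1),
        {q : D.cone × D.cone | (q.1 : Fin (p + 1) → ℂ) i * (q.2 : Fin (p + 1) → ℂ) j =
          (q.1 : Fin (p + 1) → ℂ) j * (q.2 : Fin (p + 1) → ℂ) i} := by
    ext q
    simp only [Set.mem_setOf_eq, toBall_eq_toBall_iff_minors, Set.mem_iInter]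
  rw [hset]
  refine isClosed_iInter fun i ↦ isClosed_iInter fun j ↦ isClosed_eq ?_ ?_
  · exact (((continuous_apply i).comp continuous_subtype_val).comp continuous_fst).mul
      (((continuous_apply j).comp continuous_subtype_val).comp continuous_snd)
  · exact (((continuous_apply j).comp continuous_subtype_val).comp continuous_fst).mul
      (((continuous_apply i).comp continuous_subtype_val).comp continuous_snd)

/-- The negative cone, an open subset of `ℂ^{p+1}`, is locally compact. [folklore] -/
theorem locallyCompactSpace_cone : LocallyCompactSpace D.cone :=
  (isOpen_negCone D.Hℂ).locallyCompactSpace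

/-- **The ball is locally compact**: it is the image of the locally compact cone under the open
quotient map `toBall`. [cite: BergeronMillsonMoeglin2016Balls, Part 2 §1.3] -/
theorem locallyCompactSpace_ball : LocallyCompactSpace D.ball :=
  haveI := locallyCompactSpace_cone D
  (isOpenQuotientMap_toBall D).locallyCompactSpace

end BallTopology

/-- **REGISTERED STUB `stub_ballLocallyCompactT2` (seat c2): the ball `𝔹 = cone / ℂˣ` of negative
lines of `V_{τ₁}`, with the quotient topology, is locally compact and Hausdorff** — the point-set half
of prerequisite (G1) of `stub_levelCoveringOfProperlyDiscontinuous` / `stub_heckeGraphAnalytic`.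
Hausdorff: `toBall` is an open quotient map whose relation (proportionality = vanishing `2 × 2`
minors of non-zero vectors) is closed; locally compact: open quotient of the open cone in `ℂ^{p+1}`.
[cite: BergeronMillsonMoeglin2016Balls, Part 2 §1.3] -/
theorem stub_ballLocallyCompactT2 :
    ∀ {p : ℕ} {X : SchemeOver ℂ} (D : UnitaryBallQuotientDatum p X),
      LocallyCompactSpace D.ball ∧ T2Space D.ball :=
  fun D ↦ ⟨BallTopology.locallyCompactSpace_ball D, BallTopology.t2Space_ball D⟩

end Summit.HodgeConjecture.HodgeConjecture.Cruxes.OrthogonalEnveloped.HeckeGraphChow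

end
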